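import Summits.NavierStokesRegularity.NavierStokesRegularity.Theorems.PerpetualPumpCircuitTraceValveBudgetBurn
import HarnessLib

/-!
# `PerpetualPump.CircuitTrace`, line `tilted-trace-gronwall`, stub S1: the QUIET-VALVE BUDGET

Registered stub `stub_valveBudget` of crux stmt-NavierStokesRegularity-1836 (`PerpetualPump.CircuitTrace`), lead
prover; parts I–II are `PerpetualPumpCircuitTraceValveBudgetIdentity.lean` / `…ValveBudgetBurn.lean`.
Units: critical amplitude `a_{i,n} = lam^{n/5}|X_{i,n}|`, clock of scale `n` = `lam^{4n/5}`.

**Statement.** For every cyclic Tao circuit and amplitude bound `A` there are `δ₀ = 1/(2(K+1)(m+1)³) > 0`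
(`K = max|coeff|`) and `C = 2m(A⁺)²/(1 - lam^{-2/5})` such that for `0 < δ ≤ δ₀`, in every solution of the crux's
class with `sup a ≤ A`: if the valve scale `n ≥ 0` is `δ`-quiet on `[t₁,t₂] ⊂ (0,T)` while at every instant some
mode strictly above `n` is `δ`-active, then `δ² · lam^{4(n+1)/5} · (t₂ - t₁) ≤ C`.

**Proof.** The a-priori `H¹⁰` bound on `[0,t₂]` gives `|X_{i,j}| ≤ C₂' lam^{-4j}` on the window, hence all scales
above some `J` are `δ`-quiet there (`valveBudget_quiet_above`) and the top flux of the block `n+1..n+L` is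
`O(lam^{-L})` (`valveBudget_top_flux`); the mean value theorem for the block energy with the pointwise burn
rate (part II) and `0 ≤ ℰ_L`, `ℰ_L(t₁) ≤ m A⁺² lam^{-2(n+1)/5}/(1 - lam^{-2/5})` (`valveBudget_block_energy_le`)
give the budget up to `O(lam^{-L})` (`valveBudget_window`); let `L → ∞`.
-/

noncomputable section

-- the nested summit namespace `…NavierStokesRegularity.NavierStokesRegularity…` is the tree's layout (D-0017)
set_option linter.dupNamespace false

namespace Summit.NavierStokesRegularity.NavierStokesRegularity.Theorems.PerpetualPumpCircuitTrace

open Finset Real Set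
open Summit.NavierStokesRegularity.NavierStokesRegularity.Theorems.CircuitTrace.Negative

/-! ## The budget -/

/-- Geometric bound for the block energy at the start of the window:
`Σ_{l<L} Σ_i X_{i,n+1+l}(t)² ≤ m A'² lam^{-2(n+1)/5} (1 - lam^{-2/5})⁻¹` when `lam^{j/5}|X_{i,j}(t)| ≤ A'`, `A' ≥ 0`.
[folklore] -/
theorem valveBudget_block_energy_le {lam : ℝ} (hlam : 1 < lam) {m : ℕ} (X : Fin m → ℤ → ℝ → ℝ) (n : ℤ)
    (L : ℕ) (t : ℝ) {A' : ℝ}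
    (hA' : ∀ (i : Fin m) (j : ℤ), lam ^ ((1 / 5 : ℝ) * j) * |X i j t| ≤ A') :
    ∑ l ∈ Finset.range L, ∑ i : Fin m, (X i (n + 1 + l) t) ^ 2
      ≤ (m : ℝ) * A' ^ 2 * lam ^ (-((2 / 5 : ℝ) * ((n : ℝ) + 1))) * (1 - lam ^ (-(2 / 5 : ℝ)))⁻¹ := by
  have hlam0 : 0 < lam := by linarith
  set r : ℝ := lam ^ (-(2 / 5 : ℝ)) with hrdef
  have hr0 : 0 ≤ r := (Real.rpow_pos_of_pos hlam0 _).le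
  have hr1 : r < 1 := Real.rpow_lt_one_of_one_lt_of_neg hlam (by norm_num)
  have hsq : ∀ a : ℝ, (lam ^ a) ^ 2 = lam ^ (2 * a) := fun a => by
    rw [← Real.rpow_natCast, ← Real.rpow_mul hlam0.le]; congr 1; push_cast; ring
  have hrl : ∀ l : ℕ, r ^ l = lam ^ (-(2 / 5 : ℝ) * l) := fun l => by
    rw [hrdef, ← Real.rpow_natCast, ← Real.rpow_mul hlam0.le]
  have hterm : ∀ (l : ℕ) (i : Fin m), (X i (n + 1 + l) t) ^ 2
      ≤ A' ^ 2 * lam ^ (-((2 / 5 : ℝ) * ((n : ℝ) + 1))) * r ^ l := by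
    intro l i
    have h1 := valveBudget_abs_le_of_amp_le hlam0 (hA' i (n + 1 + l))
    have h2 : (X i (n + 1 + l) t) ^ 2 ≤ (A' * lam ^ (-((1 / 5 : ℝ) * ((n + 1 + l : ℤ) : ℝ)))) ^ 2 := by
      rw [← sq_abs (X i (n + 1 + l) t)]
      exact pow_le_pow_left₀ (abs_nonneg _) h1 2
    have e : (A' * lam ^ (-((1 / 5 : ℝ) * ((n + 1 + l : ℤ) : ℝ)))) ^ 2
        = A' ^ 2 * lam ^ (-((2 / 5 : ℝ) * ((n : ℝ) + 1))) * r ^ l := by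
      rw [mul_pow, hsq, hrl, mul_assoc, ← Real.rpow_add hlam0]
      congr 2; push_cast; ring
    rw [e] at h2
    exact h2
  calc ∑ l ∈ Finset.range L, ∑ i : Fin m, (X i (n + 1 + l) t) ^ 2
      ≤ ∑ l ∈ Finset.range L, ∑ _i : Fin m, A' ^ 2 * lam ^ (-((2 / 5 : ℝ) * ((n : ℝ) + 1))) * r ^ l :=
        Finset.sum_le_sum fun l _ => Finset.sum_le_sum fun i _ => hterm l i
    _ = (m : ℝ) * A' ^ 2 * lam ^ (-((2 / 5 : ℝ) * ((n : ℝ) + 1))) * ∑ l ∈ Finset.range L, r ^ l := by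
        rw [Finset.mul_sum]
        refine Finset.sum_congr rfl fun l _ => ?_
        rw [Finset.sum_const, Finset.card_univ, Fintype.card_fin, nsmul_eq_mul]
        ring
    _ ≤ (m : ℝ) * A' ^ 2 * lam ^ (-((2 / 5 : ℝ) * ((n : ℝ) + 1))) * (1 - r)⁻¹ := by
        refine mul_le_mul_of_nonneg_left ?_ ?_
        · exact sum_le_hasSum (Finset.range L) (fun l _ => pow_nonneg hr0 l)
            (hasSum_geometric_of_lt_one hr0 hr1)
        · exact mul_nonneg (mul_nonneg (Nat.cast_nonneg m) (sq_nonneg _)) (Real.rpow_pos_of_pos hlam0 _).le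

/-- The smallness of `δ` used by the pointwise lemma: `δ ≤ 1/(2(K+1)(m+1)³)` gives
`m K² m⁴ lam^{-6/5} δ² ≤ 1/2` for `lam ≥ 1`. [folklore] -/
theorem valveBudget_smallness {lam K δ : ℝ} {m : ℕ} (hlam : 1 ≤ lam) (hK0 : 0 ≤ K) (hδ : 0 ≤ δ)
    (hδle : δ ≤ 1 / (2 * (K + 1) * ((m : ℝ) + 1) ^ 3)) :
    (m : ℝ) * K ^ 2 * (m : ℝ) ^ 4 * lam ^ (-(6 / 5 : ℝ)) * δ ^ 2 ≤ 1 / 2 := by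
  have hl1 : lam ^ (-(6 / 5 : ℝ)) ≤ 1 := Real.rpow_le_one_of_one_le_of_nonpos hlam (by norm_num)
  have hm0 : (0 : ℝ) ≤ m := Nat.cast_nonneg m
  have hu : δ * ((K + 1) * ((m : ℝ) + 1) ^ 3) ≤ 1 / 2 := by
    have := mul_le_mul_of_nonneg_right hδle (show (0 : ℝ) ≤ (K + 1) * ((m : ℝ) + 1) ^ 3 by positivity)
    calc δ * ((K + 1) * ((m : ℝ) + 1) ^ 3) ≤ 1 / (2 * (K + 1) * ((m : ℝ) + 1) ^ 3)
          * ((K + 1) * ((m : ℝ) + 1) ^ 3) := this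
      _ = 1 / 2 := by field_simp
  have hu0 : 0 ≤ δ * ((K + 1) * ((m : ℝ) + 1) ^ 3) := by positivity
  have hu2 : (δ * ((K + 1) * ((m : ℝ) + 1) ^ 3)) ^ 2 ≤ (1 / 2) ^ 2 := pow_le_pow_left₀ hu0 hu 2
  have h1 : (m : ℝ) * (m : ℝ) ^ 4 ≤ ((m : ℝ) + 1) ^ 6 := by
    have h5 : (m : ℝ) ^ 5 ≤ ((m : ℝ) + 1) ^ 5 := pow_le_pow_left₀ hm0 (by linarith) 5
    have h6 : ((m : ℝ) + 1) ^ 5 ≤ ((m : ℝ) + 1) ^ 6 := by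
      calc ((m : ℝ) + 1) ^ 5 = ((m : ℝ) + 1) ^ 5 * 1 := (mul_one _).symm
        _ ≤ ((m : ℝ) + 1) ^ 5 * ((m : ℝ) + 1) := by gcongr; linarith [hm0]
        _ = ((m : ℝ) + 1) ^ 6 := by ring
    calc (m : ℝ) * (m : ℝ) ^ 4 = (m : ℝ) ^ 5 := by ring
      _ ≤ ((m : ℝ) + 1) ^ 6 := h5.trans h6
  have h2 : K ^ 2 ≤ (K + 1) ^ 2 := pow_le_pow_left₀ hK0 (by linarith) 2
  calc (m : ℝ) * K ^ 2 * (m : ℝ) ^ 4 * lam ^ (-(6 / 5 : ℝ)) * δ ^ 2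
      = (K ^ 2 * ((m : ℝ) * (m : ℝ) ^ 4)) * lam ^ (-(6 / 5 : ℝ)) * δ ^ 2 := by ring
    _ ≤ ((K + 1) ^ 2 * ((m : ℝ) + 1) ^ 6) * 1 * δ ^ 2 := by gcongr
    _ = (δ * ((K + 1) * ((m : ℝ) + 1) ^ 3)) ^ 2 := by ring
    _ ≤ (1 / 2) ^ 2 := hu2
    _ ≤ 1 / 2 := by norm_num

/-- Under the a-priori bound `|X_{i,j}| ≤ C₂' lam^{-4j}` on a window, all but finitely many scales are
`δ`-quiet there (in critical units `lam^{j/5}|X_{i,j}| ≤ C₂' lam^{-19j/5}`). [folklore] -/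
theorem valveBudget_quiet_above {lam : ℝ} (hlam : 1 < lam) {m : ℕ} (X : Fin m → ℤ → ℝ → ℝ) (t₁ t₂ : ℝ)
    {C₂' δ : ℝ} (hC₂'0 : 0 ≤ C₂') (hδ : 0 < δ)
    (hXap : ∀ (i : Fin m) (j : ℤ), ∀ t ∈ Set.Icc t₁ t₂, |X i j t| ≤ C₂' * lam ^ (-((4 : ℝ) * j))) :
    ∃ J : ℕ, ∀ (i : Fin m) (j : ℤ), (J : ℤ) < j → ∀ t ∈ Set.Icc t₁ t₂,
      lam ^ ((1 / 5 : ℝ) * j) * |X i j t| < δ := by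
  have hlam0 : 0 < lam := by linarith
  have hρ1 : lam⁻¹ < 1 := inv_lt_one_of_one_lt₀ hlam
  have hρ0 : 0 < lam⁻¹ := inv_pos.mpr hlam0
  obtain ⟨J, hJ⟩ := exists_pow_lt_of_lt_one (show 0 < δ / (C₂' + 1) by positivity) hρ1
  refine ⟨J, fun i j hj t ht => ?_⟩
  have hj0 : (0 : ℝ) < j := by exact_mod_cast (lt_of_le_of_lt (Int.natCast_nonneg J) hj)
  have h1 : lam ^ ((1 / 5 : ℝ) * j) * |X i j t| ≤ C₂' * lam ^ (-(j : ℝ)) := by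
    have h2 := hXap i j t ht
    calc lam ^ ((1 / 5 : ℝ) * j) * |X i j t| ≤ lam ^ ((1 / 5 : ℝ) * j) * (C₂' * lam ^ (-((4 : ℝ) * j))) :=
          mul_le_mul_of_nonneg_left h2 (Real.rpow_pos_of_pos hlam0 _).le
      _ = C₂' * lam ^ (-((19 / 5 : ℝ) * j)) := by
          rw [mul_left_comm, ← Real.rpow_add hlam0]; congr 2; ring
      _ ≤ C₂' * lam ^ (-(j : ℝ)) := by
          refine mul_le_mul_of_nonneg_left (Real.rpow_le_rpow_of_exponent_le hlam.le ?_) hC₂'0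
          linarith
  have h3 : lam ^ (-(j : ℝ)) ≤ lam⁻¹ ^ J := by
    rw [← Real.rpow_neg_one, ← Real.rpow_natCast, ← Real.rpow_mul hlam0.le]
    refine Real.rpow_le_rpow_of_exponent_le hlam.le ?_
    have : ((J : ℤ) : ℝ) < (j : ℝ) := by exact_mod_cast hj
    push_cast at this ⊢
    linarith
  have h4 : C₂' * lam⁻¹ ^ J < δ := by
    have h5 : lam⁻¹ ^ J * (C₂' + 1) < δ := (lt_div_iff₀ (by positivity)).mp hJ
    have h6 : 0 ≤ lam⁻¹ ^ J := pow_nonneg hρ0.le J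
    nlinarith
  calc lam ^ ((1 / 5 : ℝ) * j) * |X i j t| ≤ C₂' * lam ^ (-(j : ℝ)) := h1
    _ ≤ C₂' * lam⁻¹ ^ J := mul_le_mul_of_nonneg_left h3 hC₂'0
    _ < δ := h4

/-- Under the a-priori bound `|X_{i,j}| ≤ C₂' lam^{-4j}` on a window and `n ≥ 0`, the TOP flux out of the block
`n+1..n+L` is `O(lam^{-L})`: `|π_{n+L}| ≤ 2Km³C₂'³ · lam^{-L}`. [folklore] -/
theorem valveBudget_top_flux {lam : ℝ} (hlam : 1 < lam) {m : ℕ}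
    (coeff : Fin m → Fin m → Fin m → Option (Fin 3) → ℝ) {K : ℝ} (hK0 : 0 ≤ K)
    (hK : ∀ i₁ i₂ i₃ μ, |coeff i₁ i₂ i₃ μ| ≤ K) (X : Fin m → ℤ → ℝ → ℝ) {n : ℤ} (hn : 0 ≤ n) (t₁ t₂ : ℝ)
    {C₂' : ℝ} (hC₂'0 : 0 ≤ C₂')
    (hXap : ∀ (i : Fin m) (j : ℤ), ∀ t ∈ Set.Icc t₁ t₂, |X i j t| ≤ C₂' * lam ^ (-((4 : ℝ) * j)))
    (L : ℕ) (t : ℝ) (ht : t ∈ Set.Icc t₁ t₂) :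
    |2 * lam ^ ((n + L : ℤ) : ℝ) * (∑ i₁ : Fin m, ∑ i₂ : Fin m, ∑ i₃ : Fin m,
        coeff i₁ i₂ i₃ (some 2) * X i₁ (n + L) t * X i₂ (n + L) t * X i₃ (n + L + 1) t)|
      ≤ (2 * K * (m : ℝ) ^ 3 * C₂' ^ 3) * lam ^ (-(L : ℝ)) := by
  have hlam0 : 0 < lam := by linarith
  have hB0 : 0 ≤ C₂' * lam ^ (-((4 : ℝ) * ((n + L : ℤ) : ℝ))) :=
    mul_nonneg hC₂'0 (Real.rpow_pos_of_pos hlam0 _).le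
  have h1 := valveBudget_flux_abs_le coeff hK0 hK (fun i => X i (n + L) t) (fun i => X i (n + L + 1) t)
    hB0 (fun i => hXap i (n + L) t ht)
  have hZ : ∑ i₃ : Fin m, |X i₃ (n + L + 1) t|
      ≤ (m : ℝ) * (C₂' * lam ^ (-((4 : ℝ) * ((n + L + 1 : ℤ) : ℝ)))) := by
    calc ∑ i₃ : Fin m, |X i₃ (n + L + 1) t|
        ≤ ∑ _i₃ : Fin m, C₂' * lam ^ (-((4 : ℝ) * ((n + L + 1 : ℤ) : ℝ))) :=
          Finset.sum_le_sum fun i _ => hXap i (n + L + 1) t ht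
      _ = _ := by rw [Finset.sum_const, Finset.card_univ, Fintype.card_fin, nsmul_eq_mul]
  rw [abs_mul, abs_mul, abs_of_pos (show (0 : ℝ) < 2 by norm_num), abs_of_pos (Real.rpow_pos_of_pos hlam0 _)]
  have hsq : ∀ a : ℝ, (lam ^ a) ^ 2 = lam ^ (2 * a) := fun a => by
    rw [← Real.rpow_natCast, ← Real.rpow_mul hlam0.le]; congr 1; push_cast; ring
  have hpow : lam ^ ((n + L : ℤ) : ℝ) * (lam ^ (-((4 : ℝ) * ((n + L : ℤ) : ℝ)))) ^ 2
      * lam ^ (-((4 : ℝ) * ((n + L + 1 : ℤ) : ℝ))) ≤ lam ^ (-(L : ℝ)) := by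
    rw [hsq, ← Real.rpow_add hlam0, ← Real.rpow_add hlam0]
    refine Real.rpow_le_rpow_of_exponent_le hlam.le ?_
    have hn0 : (0 : ℝ) ≤ n := by exact_mod_cast hn
    have hL0 : (0 : ℝ) ≤ L := Nat.cast_nonneg L
    push_cast
    nlinarith
  have hE₀0 : 0 ≤ 2 * K * (m : ℝ) ^ 3 * C₂' ^ 3 := by positivity
  calc 2 * lam ^ ((n + L : ℤ) : ℝ) * |∑ i₁ : Fin m, ∑ i₂ : Fin m, ∑ i₃ : Fin m,
        coeff i₁ i₂ i₃ (some 2) * X i₁ (n + L) t * X i₂ (n + L) t * X i₃ (n + L + 1) t|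
      ≤ 2 * lam ^ ((n + L : ℤ) : ℝ) * (K * (C₂' * lam ^ (-((4 : ℝ) * ((n + L : ℤ) : ℝ)))) ^ 2 * (m : ℝ) ^ 2
          * ((m : ℝ) * (C₂' * lam ^ (-((4 : ℝ) * ((n + L + 1 : ℤ) : ℝ)))))) := by
        refine mul_le_mul_of_nonneg_left (h1.trans ?_)
          (mul_nonneg (by norm_num) (Real.rpow_pos_of_pos hlam0 _).le)
        exact mul_le_mul_of_nonneg_left hZ (by positivity)
    _ = (2 * K * (m : ℝ) ^ 3 * C₂' ^ 3) * (lam ^ ((n + L : ℤ) : ℝ) * (lam ^ (-((4 : ℝ) * ((n + L : ℤ) : ℝ)))) ^ 2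
          * lam ^ (-((4 : ℝ) * ((n + L + 1 : ℤ) : ℝ)))) := by ring
    _ ≤ (2 * K * (m : ℝ) ^ 3 * C₂' ^ 3) * lam ^ (-(L : ℝ)) := mul_le_mul_of_nonneg_left hpow hE₀0

/-- **The budget on one window, up to the top-flux error.** With all the window data of `stub_valveBudget`
in hand (cyclic circuit solved on the window, valve `δ`-quiet, an active mode above the valve at every instant,
amplitudes `≤ A'`, a-priori bound `C₂'`, smallness of `δ`) and a block length `L` beyond the quiet threshold `J`,
the mean value theorem applied to the block energy gives
`δ² lam^{4(n+1)/5} (t₂ - t₁) ≤ 2 m A'² (1 - lam^{-2/5})⁻¹ + 2 lam^{2(n+1)/5} E₀ (t₂ - t₁) lam^{-L}`. [folklore] -/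
theorem valveBudget_window {lam : ℝ} (hlam : 1 < lam) {m : ℕ}
    {coeff : Fin m → Fin m → Fin m → Option (Fin 3) → ℝ} (hcyc : IsCyclic coeff) {K : ℝ} (hK0 : 0 ≤ K)
    (hK : ∀ i₁ i₂ i₃ μ, |coeff i₁ i₂ i₃ μ| ≤ K) (X : Fin m → ℤ → ℝ → ℝ) {n : ℤ} (hn : 0 ≤ n) {t₁ t₂ : ℝ}
    (hlt : t₁ < t₂) {δ A' C₂' : ℝ} (hδ : 0 < δ) (hC₂'0 : 0 ≤ C₂')
    (hsmall : (m : ℝ) * K ^ 2 * (m : ℝ) ^ 4 * lam ^ (-(6 / 5 : ℝ)) * δ ^ 2 ≤ 1 / 2)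
    (hderiv : ∀ (i : Fin m) (j : ℤ), ∀ t ∈ Set.Icc t₁ t₂, HasDerivAt (X i j) (circuitRHS lam coeff X i j t) t)
    (hamp : ∀ (i : Fin m) (j : ℤ), lam ^ ((1 / 5 : ℝ) * j) * |X i j t₁| ≤ A')
    (hXap : ∀ (i : Fin m) (j : ℤ), ∀ t ∈ Set.Icc t₁ t₂, |X i j t| ≤ C₂' * lam ^ (-((4 : ℝ) * j)))
    (hvalve : ∀ i : Fin m, ∀ t ∈ Set.Icc t₁ t₂, lam ^ ((1 / 5 : ℝ) * n) * |X i n t| ≤ δ)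
    (hact : ∀ t ∈ Set.Icc t₁ t₂, ∃ (i : Fin m) (j : ℤ), n < j ∧ δ ≤ lam ^ ((1 / 5 : ℝ) * j) * |X i j t|)
    {J : ℕ} (hJ : ∀ (i : Fin m) (j : ℤ), (J : ℤ) < j → ∀ t ∈ Set.Icc t₁ t₂,
      lam ^ ((1 / 5 : ℝ) * j) * |X i j t| < δ)
    (L : ℕ) (hJL : J ≤ L) :
    δ ^ 2 * lam ^ ((4 / 5 : ℝ) * ((n : ℝ) + 1)) * (t₂ - t₁)
      ≤ 2 * (m : ℝ) * A' ^ 2 * (1 - lam ^ (-(2 / 5 : ℝ)))⁻¹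
        + 2 * lam ^ ((2 / 5 : ℝ) * ((n : ℝ) + 1)) * (2 * K * (m : ℝ) ^ 3 * C₂' ^ 3) * (t₂ - t₁)
          * lam ^ (-(L : ℝ)) := by
  have hlam0 : 0 < lam := by linarith
  -- the block energy and its derivative on the window
  have hD : ∀ s ∈ Set.Icc t₁ t₂, HasDerivAt
      (fun s => ∑ l ∈ Finset.range L, ∑ i : Fin m, (X i (n + 1 + l) s) ^ 2)
      (-(∑ l ∈ Finset.range L, 2 * lam ^ ((4 / 5 : ℝ) * ((n + 1 + l : ℤ) : ℝ)) *
            ∑ i : Fin m, (X i (n + 1 + l) s) ^ 2)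
        + 2 * lam ^ ((n : ℤ) : ℝ) * (∑ i₁ : Fin m, ∑ i₂ : Fin m, ∑ i₃ : Fin m,
            coeff i₁ i₂ i₃ (some 2) * X i₁ n s * X i₂ n s * X i₃ (n + 1) s)
        - 2 * lam ^ ((n + L : ℤ) : ℝ) * (∑ i₁ : Fin m, ∑ i₂ : Fin m, ∑ i₃ : Fin m,
            coeff i₁ i₂ i₃ (some 2) * X i₁ (n + L) s * X i₂ (n + L) s * X i₃ (n + L + 1) s)) s :=
    fun s hs => valveBudget_block_hasDerivAt hcyc X n L s (fun i j => hderiv i j s hs)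
  obtain ⟨ξ, hξ, hslope⟩ := exists_hasDerivAt_eq_slope
    (fun s => ∑ l ∈ Finset.range L, ∑ i : Fin m, (X i (n + 1 + l) s) ^ 2) _ hlt
    (fun s hs => (hD s hs).continuousAt.continuousWithinAt)
    (fun s hs => hD s (Set.Ioo_subset_Icc_self hs))
  have hξ' : ξ ∈ Set.Icc t₁ t₂ := Set.Ioo_subset_Icc_self hξ
  -- the active mode at ξ lies inside the block
  obtain ⟨iS, jS, hnj, hδa⟩ := hact ξ hξ'
  have hjL : jS ≤ n + L := by
    by_contra hcon
    have hj : (J : ℤ) < jS := by push Not at hcon; omega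
    have := hJ iS jS hj ξ hξ'
    linarith
  have hpt := valveBudget_pointwise lam hlam m coeff K hK0 hK X n L ξ δ _ hδ.le hsmall
    (fun i => hvalve i ξ hξ') ⟨iS, jS, hnj, hjL, hδa⟩
    (valveBudget_top_flux hlam coeff hK0 hK X hn t₁ t₂ hC₂'0 hXap L ξ hξ')
  rw [hslope] at hpt
  -- energy at the endpoints
  have hE2 : 0 ≤ ∑ l ∈ Finset.range L, ∑ i : Fin m, (X i (n + 1 + l) t₂) ^ 2 :=
    Finset.sum_nonneg fun l _ => Finset.sum_nonneg fun i _ => sq_nonneg _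
  have hE1 := valveBudget_block_energy_le hlam X n L t₁ hamp
  have hdt : 0 < t₂ - t₁ := by linarith
  have hkey : (δ ^ 2 / 2) * lam ^ ((2 / 5 : ℝ) * ((n : ℝ) + 1)) * (t₂ - t₁)
      ≤ (m : ℝ) * A' ^ 2 * lam ^ (-((2 / 5 : ℝ) * ((n : ℝ) + 1))) * (1 - lam ^ (-(2 / 5 : ℝ)))⁻¹
        + (2 * K * (m : ℝ) ^ 3 * C₂' ^ 3) * lam ^ (-(L : ℝ)) * (t₂ - t₁) := by
    have h1 := (div_le_iff₀ hdt).mp hpt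
    linarith [h1, hE2, hE1]
  have hΛ : 0 < lam ^ ((2 / 5 : ℝ) * ((n : ℝ) + 1)) := Real.rpow_pos_of_pos hlam0 _
  have h3 := mul_le_mul_of_nonneg_left hkey (show (0 : ℝ) ≤ 2 * lam ^ ((2 / 5 : ℝ) * ((n : ℝ) + 1)) by
    positivity)
  have e : lam ^ ((4 / 5 : ℝ) * ((n : ℝ) + 1))
      = lam ^ ((2 / 5 : ℝ) * ((n : ℝ) + 1)) * lam ^ ((2 / 5 : ℝ) * ((n : ℝ) + 1)) := by
    rw [← Real.rpow_add hlam0]; congr 1; ring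
  have e' : lam ^ ((2 / 5 : ℝ) * ((n : ℝ) + 1)) * lam ^ (-((2 / 5 : ℝ) * ((n : ℝ) + 1))) = 1 := by
    rw [Real.rpow_neg hlam0.le, mul_inv_cancel₀ hΛ.ne']
  have e'' : 2 * lam ^ ((2 / 5 : ℝ) * ((n : ℝ) + 1))
      * ((m : ℝ) * A' ^ 2 * lam ^ (-((2 / 5 : ℝ) * ((n : ℝ) + 1))) * (1 - lam ^ (-(2 / 5 : ℝ)))⁻¹)
      = 2 * (m : ℝ) * A' ^ 2 * (1 - lam ^ (-(2 / 5 : ℝ)))⁻¹ := by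
    calc 2 * lam ^ ((2 / 5 : ℝ) * ((n : ℝ) + 1))
          * ((m : ℝ) * A' ^ 2 * lam ^ (-((2 / 5 : ℝ) * ((n : ℝ) + 1))) * (1 - lam ^ (-(2 / 5 : ℝ)))⁻¹)
        = 2 * (m : ℝ) * A' ^ 2 * (1 - lam ^ (-(2 / 5 : ℝ)))⁻¹
            * (lam ^ ((2 / 5 : ℝ) * ((n : ℝ) + 1)) * lam ^ (-((2 / 5 : ℝ) * ((n : ℝ) + 1)))) := by ring
      _ = 2 * (m : ℝ) * A' ^ 2 * (1 - lam ^ (-(2 / 5 : ℝ)))⁻¹ := by rw [e', mul_one]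
  rw [e]
  linarith [h3, e'']

/-- **S1, the QUIET-VALVE BUDGET** (registered stub `stub_valveBudget` of crux stmt-NavierStokesRegularity-1836,
line `tilted-trace-gronwall`). For every cyclic circuit and amplitude bound `A` there are `δ₀ > 0` and `C` such that
for `0 < δ ≤ δ₀`, in every solution of the crux's class with `sup a ≤ A`: if the valve scale `n ≥ 0` is `δ`-quiet on
`[t₁,t₂] ⊂ (0,T)` while at every instant some mode strictly above `n` is `δ`-active, then
`δ² · lam^{4(n+1)/5} · (t₂ - t₁) ≤ C`. -/
theorem stub_valveBudget :
    ∀ lam : ℝ, 1 < lam → ∀ (m : ℕ) (coeff : Fin m → Fin m → Fin m → Option (Fin 3) → ℝ),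
    IsCyclic coeff → ∀ A : ℝ, ∃ δ₀ : ℝ, 0 < δ₀ ∧ ∃ C : ℝ, ∀ δ : ℝ, 0 < δ → δ ≤ δ₀ →
    ∀ (T : ℝ) (X : Fin m → ℤ → ℝ → ℝ), 0 < T →
    (∀ (i : Fin m) (n : ℤ), ∀ t ∈ Set.Ioo 0 T, HasDerivAt (X i n) (circuitRHS lam coeff X i n t) t) →
    (∀ (i : Fin m) (n : ℤ) (t : ℝ), n < 0 → X i n t = 0) →
    (∀ T' ∈ Set.Ioo 0 T, ∃ C : ℝ, ∀ (i : Fin m) (n : ℤ), ∀ t ∈ Set.Icc 0 T',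
      lam ^ ((4 : ℝ) * n) * |X i n t| ≤ C) →
    (∀ t ∈ Set.Ico 0 T, ∀ (i : Fin m) (n : ℤ), lam ^ ((1 / 5 : ℝ) * n) * |X i n t| ≤ A) →
    ∀ n : ℤ, 0 ≤ n → ∀ t₁ t₂ : ℝ, 0 < t₁ → t₁ ≤ t₂ → t₂ < T →
    (∀ i : Fin m, ∀ t ∈ Set.Icc t₁ t₂, lam ^ ((1 / 5 : ℝ) * n) * |X i n t| ≤ δ) →
    (∀ t ∈ Set.Icc t₁ t₂, ∃ (i : Fin m) (j : ℤ), n < j ∧ δ ≤ lam ^ ((1 / 5 : ℝ) * j) * |X i j t|) →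
    δ ^ 2 * lam ^ ((4 / 5 : ℝ) * (n + 1)) * (t₂ - t₁) ≤ C := by
  intro lam hlam m coeff hcyc A
  obtain ⟨K, hK0, hK⟩ := exists_coeff_bound coeff
  have hlam0 : 0 < lam := by linarith
  have hr1 : lam ^ (-(2 / 5 : ℝ)) < 1 := Real.rpow_lt_one_of_one_lt_of_neg hlam (by norm_num)
  have hC0 : 0 ≤ 2 * (m : ℝ) * (max A 0) ^ 2 * (1 - lam ^ (-(2 / 5 : ℝ)))⁻¹ := by
    have : 0 < (1 - lam ^ (-(2 / 5 : ℝ)))⁻¹ := inv_pos.mpr (by linarith)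
    positivity
  refine ⟨1 / (2 * (K + 1) * ((m : ℝ) + 1) ^ 3), by positivity,
    2 * (m : ℝ) * (max A 0) ^ 2 * (1 - lam ^ (-(2 / 5 : ℝ)))⁻¹, ?_⟩
  intro δ hδ hδle T X _hT hderiv _hcut hapr hA n hn t₁ t₂ ht₁ ht₁₂ ht₂T hvalve hact
  have hsmall := valveBudget_smallness (m := m) hlam.le hK0 hδ.le hδle
  -- trivial window
  rcases eq_or_lt_of_le ht₁₂ with heq | hlt
  · rw [heq, sub_self, mul_zero]; exact hC0
  -- the a-priori bound on [0, t₂]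
  obtain ⟨C₂, hC₂⟩ := hapr t₂ ⟨by linarith, ht₂T⟩
  have hC₂'0 : 0 ≤ max C₂ 0 := le_max_right _ _
  have hXap : ∀ (i : Fin m) (j : ℤ), ∀ t ∈ Set.Icc t₁ t₂, |X i j t| ≤ max C₂ 0 * lam ^ (-((4 : ℝ) * j)) := by
    intro i j t ht
    have h := hC₂ i j t ⟨by linarith [ht.1], ht.2⟩
    exact valveBudget_abs_le_of_amp_le hlam0 (h.trans (le_max_left _ _))
  have hamp : ∀ (i : Fin m) (j : ℤ), lam ^ ((1 / 5 : ℝ) * j) * |X i j t₁| ≤ max A 0 :=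
    fun i j => (hA t₁ ⟨by linarith, by linarith⟩ i j).trans (le_max_left _ _)
  have hderiv' : ∀ (i : Fin m) (j : ℤ), ∀ t ∈ Set.Icc t₁ t₂,
      HasDerivAt (X i j) (circuitRHS lam coeff X i j t) t :=
    fun i j t ht => hderiv i j t ⟨by linarith [ht.1], by linarith [ht.2]⟩
  obtain ⟨J, hJ⟩ := valveBudget_quiet_above hlam X t₁ t₂ hC₂'0 hδ hXap
  have hmain := fun L : ℕ => valveBudget_window hlam hcyc hK0 hK X hn hlt hδ hC₂'0 hsmall hderiv' hamp hXap
    hvalve hact hJ L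
  -- let L → ∞
  have hρ1 : lam⁻¹ < 1 := inv_lt_one_of_one_lt₀ hlam
  have hρ0 : 0 < lam⁻¹ := inv_pos.mpr hlam0
  refine le_of_forall_pos_lt_add fun η hη => ?_
  obtain ⟨c₀, hc₀def⟩ : ∃ c₀ : ℝ, c₀ = 2 * lam ^ ((2 / 5 : ℝ) * ((n : ℝ) + 1))
      * (2 * K * (m : ℝ) ^ 3 * (max C₂ 0) ^ 3) * (t₂ - t₁) := ⟨_, rfl⟩
  have hc₀ : 0 ≤ c₀ := by
    rw [hc₀def]
    have : 0 ≤ t₂ - t₁ := by linarith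
    have : 0 ≤ lam ^ ((2 / 5 : ℝ) * ((n : ℝ) + 1)) := (Real.rpow_pos_of_pos hlam0 _).le
    positivity
  obtain ⟨L₁, hL₁⟩ := exists_pow_lt_of_lt_one (show 0 < η / (c₀ + 1) by positivity) hρ1
  have hL := hmain (max J L₁) (le_max_left _ _)
  have hθ : lam ^ (-((max J L₁ : ℕ) : ℝ)) = lam⁻¹ ^ (max J L₁) := by
    rw [← Real.rpow_neg_one, ← Real.rpow_natCast, ← Real.rpow_mul hlam0.le]
    congr 1; ring
  have hθle : lam⁻¹ ^ (max J L₁) ≤ lam⁻¹ ^ L₁ := pow_le_pow_of_le_one hρ0.le hρ1.le (le_max_right _ _)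
  have hsmallη : c₀ * lam⁻¹ ^ L₁ < η := by
    have h1 : lam⁻¹ ^ L₁ * (c₀ + 1) < η := (lt_div_iff₀ (by positivity)).mp hL₁
    nlinarith [pow_nonneg hρ0.le L₁]
  rw [hθ, ← hc₀def] at hL
  have h7 := mul_le_mul_of_nonneg_left hθle hc₀
  linarith

end Summit.NavierStokesRegularity.NavierStokesRegularity.Theorems.PerpetualPumpCircuitTrace

end
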